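import Summits.CriticalPhenomena.SAWScalingLimit.Theorems.BoundaryTP2Negative_Enumeration
import Summits.CriticalPhenomena.SAWScalingLimit.Theorems.BoundaryTP2Negative_Box3
import Summits.CriticalPhenomena.SAWScalingLimit.Theorems.LeftRightFKG.Negative.SAWEnum
import Literature.Probability.LatticeModels.DiscreteFaceBoundary
import HarnessLib

/-!
# Negative knowledge on crux `LeftRightFKG`, part 11: certified EVENT censuses of the chords of a lattice
animal (certified-compute lane)

The `SAW.weight`-level reading of the corner certificates needs, for a concrete crux instance, the four
partition functions `Z_E(x) = Σ_{γ ∈ E} x^{|γ|}` of first-step and last-step EVENTS `E` as explicit polynomials.  This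
file is the generic kernel tool: for ANY plane set `Ω` whose domain graph `discreteDomainGraph Ω 1` is `ℤ²`
induced on a finite vertex set given by a Boolean membership test `inV` on INTEGER PAIRS (hypothesis `hB`, the
shape delivered by `Rect.dAdj_iff` for boxes and by `NotFKGAtOne.Negative.dAdj3_iff` for the `3 × 3` box),

* sites are coded as integer pairs (the tree's `Literature.Probability.LatticeModels.toZ2`, and `ofZ2`,
  `z2Equiv`) so that the kernel evaluates the enumeration on
  `ℤ × ℤ` rather than on `Fin 2 → ℤ`; the domain graph is transported along the coding (`G₂`, `iso`);
* the neighbour lister `nbV inV` is complete and sound for `G₂` (`mem_nbV`, `nbV_adj`);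
* every chord `γ : SAW.DomainSAW Ω 1 a b` has an injective CODE `code γ` (its support as integer pairs), listed
  by the tree's certified enumeration `BoundaryTP2.Negative.pathsFrom` run on `ℤ × ℤ` (`code_mem_enum`), and every
  listed code ending at `b` is the code of a chord (`exists_chord_of_mem_enum`);
* **`weightAt_eq_ofReal_sum`**: for an event `E` read on codes by a Boolean test `p`, the fugacity-`x` weight
  `weightAt x Ω 1 a b E` is `ofReal` of the list sum `Σ_{s ∈ L.filter p} x^{|s|−1}` over the enumeration `L`;
* **`sum_pow_eq_census`**: that list sum regrouped by length, `Σₙ (#codes of n+1 sites) · xⁿ` — the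
  partition POLYNOMIAL, whose coefficient list `censusList` the kernel computes by `decide`.

Everything is elementary ("folklore"); no definitions beyond the coding and the census bookkeeping.
-/

noncomputable section

namespace Summit.CriticalPhenomena.SAWScalingLimit.Theorems.LeftRightFKG.Negative.Census

open Literature.Probability.LatticeModels Literature.Probability.RandomPlanarGeometry
open Summit.CriticalPhenomena.SAWScalingLimit.Theorems.BoundaryTP2.Negative
  (pathsFrom endsAt support_mem_pathsFrom exists_walk_of_mem_pathsFrom walk_eq_of_support_eq endsAt_support
   length_lt_card_of_adj_mem zdGraph_adj_cases zdGraph_adj_of_cases)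
open scoped ENNReal

/-! ## Sites as integer pairs -/

/-- The site of an integer pair. [folklore] -/
def ofZ2 (p : ℤ × ℤ) : Site 2 := ![p.1, p.2]

/-- `ofZ2_apply_zero` (auxiliary). [folklore] -/
@[simp] theorem ofZ2_apply_zero (p : ℤ × ℤ) : ofZ2 p 0 = p.1 := rfl

/-- `ofZ2_apply_one` (auxiliary). [folklore] -/
@[simp] theorem ofZ2_apply_one (p : ℤ × ℤ) : ofZ2 p 1 = p.2 := rfl

/-- `toZ2_ofZ2` (auxiliary; `toZ2` is the tree's coding `x ↦ (x 0, x 1)`). [folklore] -/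
@[simp] theorem toZ2_ofZ2 (p : ℤ × ℤ) : toZ2 (ofZ2 p) = p := by
  simp [ofZ2]

/-- `ofZ2_toZ2` (auxiliary). [folklore] -/
@[simp] theorem ofZ2_toZ2 (u : Site 2) : ofZ2 (toZ2 u) = u := by
  funext i; fin_cases i <;> rfl

/-- The coding as an equivalence `ℤ × ℤ ≃ Site 2`. [folklore] -/
def z2Equiv : (ℤ × ℤ) ≃ Site 2 := ⟨ofZ2, toZ2, toZ2_ofZ2, ofZ2_toZ2⟩

/-- `z2Equiv_apply` (auxiliary). [folklore] -/
@[simp] theorem z2Equiv_apply (p : ℤ × ℤ) : z2Equiv p = ofZ2 p := rfl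

/-- `z2Equiv_symm_apply` (auxiliary). [folklore] -/
@[simp] theorem z2Equiv_symm_apply (u : Site 2) : z2Equiv.symm u = toZ2 u := rfl

/-- Boolean equality of integer pairs. [folklore] -/
def eqZ2 (p q : ℤ × ℤ) : Bool := (p.1 == q.1) && (p.2 == q.2)

/-- `eqZ2` is faithful. [folklore] -/
theorem eqZ2_iff (p q : ℤ × ℤ) : eqZ2 p q = true ↔ p = q := by
  obtain ⟨p1, p2⟩ := p; obtain ⟨q1, q2⟩ := q
  simp [eqZ2, Prod.ext_iff]

/-! ## The domain graph transported to integer pairs -/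

/-- The domain graph `Ω_1` pulled back to `ℤ × ℤ` along the coding. [folklore] -/
def G₂ (Ω : Set ℂ) : SimpleGraph (ℤ × ℤ) := (discreteDomainGraph Ω 1).comap z2Equiv

/-- The coding is a graph isomorphism `G₂ Ω ≃g Ω_1`. [folklore] -/
def iso (Ω : Set ℂ) : G₂ Ω ≃g discreteDomainGraph Ω 1 := SimpleGraph.Iso.comap z2Equiv _

/-- Adjacency in `G₂`, unfolded. [folklore] -/
theorem G₂_adj_iff {Ω : Set ℂ} {p q : ℤ × ℤ} : (G₂ Ω).Adj p q ↔ (discreteDomainGraph Ω 1).Adj (ofZ2 p) (ofZ2 q) :=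
  Iff.rfl

/-- Candidate neighbours inside the vertex set (for `p` inside), in the order E, W, N, S. [folklore] -/
def nbV (inV : ℤ × ℤ → Bool) (p : ℤ × ℤ) : List (ℤ × ℤ) :=
  if inV p then [(p.1 + 1, p.2), (p.1 - 1, p.2), (p.1, p.2 + 1), (p.1, p.2 - 1)].filter inV else []

section Graph

variable {Ω : Set ℂ} {inV : ℤ × ℤ → Bool}
  (hB : ∀ x y : Site 2, (discreteDomainGraph Ω 1).Adj x y ↔
    (zdGraph 2).Adj x y ∧ inV (toZ2 x) = true ∧ inV (toZ2 y) = true)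
include hB

omit hB in
/-- Lattice neighbours of a coded site are the four explicit pairs. [folklore] -/
theorem zdAdj_ofZ2_cases {p q : ℤ × ℤ} (h : (zdGraph 2).Adj (ofZ2 p) (ofZ2 q)) :
    q = (p.1 + 1, p.2) ∨ q = (p.1 - 1, p.2) ∨ q = (p.1, p.2 + 1) ∨ q = (p.1, p.2 - 1) := by
  have hq : q = toZ2 (ofZ2 q) := (toZ2_ofZ2 q).symm
  rcases zdGraph_adj_cases h with h | h | h | h <;>
    [left; (right; left); (right; right; left); (right; right; right)] <;>
    · rw [hq, h]; simp

omit hB in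
/-- The four explicit pairs are lattice neighbours of a coded site. [folklore] -/
theorem zdAdj_ofZ2_of_cases {p q : ℤ × ℤ}
    (h : q = (p.1 + 1, p.2) ∨ q = (p.1 - 1, p.2) ∨ q = (p.1, p.2 + 1) ∨ q = (p.1, p.2 - 1)) :
    (zdGraph 2).Adj (ofZ2 p) (ofZ2 q) := by
  refine zdGraph_adj_of_cases ?_
  rcases h with rfl | rfl | rfl | rfl
  · left; funext i; fin_cases i <;> rfl
  · right; left; funext i; fin_cases i <;> rfl
  · right; right; left; funext i; fin_cases i <;> rfl
  · right; right; right; funext i; fin_cases i <;> rfl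

/-- **Completeness of `nbV`** for `G₂`. [folklore] -/
theorem mem_nbV (p q : ℤ × ℤ) (h : (G₂ Ω).Adj p q) : q ∈ nbV inV p := by
  rw [G₂_adj_iff, hB] at h
  obtain ⟨hadj, hp, hq⟩ := h
  rw [toZ2_ofZ2] at hp hq
  rw [nbV, if_pos hp, List.mem_filter]
  refine ⟨?_, hq⟩
  rcases zdAdj_ofZ2_cases hadj with rfl | rfl | rfl | rfl <;> simp

/-- **Soundness of `nbV`** for `G₂`. [folklore] -/
theorem nbV_adj (p q : ℤ × ℤ) (h : q ∈ nbV inV p) : (G₂ Ω).Adj p q := by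
  unfold nbV at h
  split_ifs at h with hp
  · rw [List.mem_filter] at h
    rw [G₂_adj_iff, hB, toZ2_ofZ2, toZ2_ofZ2]
    refine ⟨zdAdj_ofZ2_of_cases ?_, hp, h.2⟩
    simpa using h.1
  · simp at h

/-! ## Codes of chords -/

omit hB in
/-- The CODE of a chord: its support as a list of integer pairs. [folklore] -/
theorem code_def {a b : Site 2} (γ : SAW.DomainSAW Ω 1 a b) :
    (γ.walk.map (iso Ω).symm.toHom).support = γ.walk.support.map toZ2 := by
  rw [SimpleGraph.Walk.support_map]
  rfl

omit hB in
/-- The code (support in integer pairs) determines the chord. [folklore] -/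
theorem code_injective {a b : Site 2} :
    Function.Injective fun γ : SAW.DomainSAW Ω 1 a b => γ.walk.support.map toZ2 := by
  intro γ γ' h
  have hs : γ.walk.support = γ'.walk.support := List.map_injective_iff.2 toZ2_injective h
  have hw := walk_eq_of_support_eq γ.walk γ'.walk hs
  cases γ; cases γ'
  simp only at hw
  subst hw
  rfl

/-- A bound on the number of vertices bounds the length of every chord. [folklore] -/
theorem length_le_of_card {T : Finset (ℤ × ℤ)} (hT : ∀ p, inV p = true → p ∈ T) {a b : Site 2}
    (ha : inV (toZ2 a) = true) {N : ℕ} (hN : T.card ≤ N + 1) (γ : SAW.DomainSAW Ω 1 a b) : γ.length ≤ N := by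
  classical
  set T' : Finset (Site 2) := T.map z2Equiv.toEmbedding with hT'
  have hmem : ∀ x : Site 2, inV (toZ2 x) = true → x ∈ T' := fun x hx => by
    rw [hT', Finset.mem_map]
    exact ⟨toZ2 x, hT _ hx, ofZ2_toZ2 x⟩
  have h := length_lt_card_of_adj_mem T' (fun x y hxy => ?_) (hmem a ha) γ.walk γ.isPath
  · rw [hT', Finset.card_map] at h
    change γ.walk.length ≤ N
    omega
  · rw [hB] at hxy
    exact ⟨hmem x hxy.2.1, hmem y hxy.2.2⟩

/-- **Completeness**: the code of every chord is listed by the enumeration run on `ℤ × ℤ` (length bound `N`)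
and ends at the code of `b`. [folklore] -/
theorem code_mem_enum {a b : Site 2} {N : ℕ} (hN : ∀ γ : SAW.DomainSAW Ω 1 a b, γ.length ≤ N)
    (γ : SAW.DomainSAW Ω 1 a b) :
    γ.walk.support.map toZ2 ∈ (pathsFrom eqZ2 (nbV inV) N (toZ2 a) []).filter (endsAt eqZ2 (toZ2 b)) := by
  set w := γ.walk.map (iso Ω).symm.toHom with hw
  have hpath : w.IsPath :=
    (SimpleGraph.Walk.isPath_map_iff_of_injective (iso Ω).symm.injective).2 γ.isPath
  have hlen : w.length ≤ N := by rw [hw, SimpleGraph.Walk.length_map]; exact hN γ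
  rw [← code_def, List.mem_filter]
  exact ⟨support_mem_pathsFrom eqZ2_iff (mem_nbV hB) N w [] hpath hlen (by simp), endsAt_support eqZ2_iff w⟩

/-- **Soundness**: every listed code ending at the code of `b` is the code of a chord `a → b`. [folklore] -/
theorem exists_chord_of_mem_enum {a b : Site 2} {N : ℕ} {s : List (ℤ × ℤ)}
    (hs : s ∈ (pathsFrom eqZ2 (nbV inV) N (toZ2 a) []).filter (endsAt eqZ2 (toZ2 b))) :
    ∃ γ : SAW.DomainSAW Ω 1 a b, γ.walk.support.map toZ2 = s := by
  rw [List.mem_filter] at hs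
  obtain ⟨v, p, hp, hsupp, -⟩ := exists_walk_of_mem_pathsFrom eqZ2_iff (nbV_adj hB) N [] s hs.1
  have hvb : v = toZ2 b := by
    have h1 := hs.2
    unfold endsAt at h1
    rw [← hsupp, List.getLast?_eq_some_getLast p.support_ne_nil, SimpleGraph.Walk.getLast_support] at h1
    exact (eqZ2_iff v _).1 h1
  subst hvb
  -- transport the path to the domain graph and fix the endpoints
  set q := (p.map (iso Ω).toHom).copy (ofZ2_toZ2 a) (ofZ2_toZ2 b) with hq
  have hqpath : q.IsPath := by
    rw [hq, SimpleGraph.Walk.isPath_copy]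
    exact (SimpleGraph.Walk.isPath_map_iff_of_injective (iso Ω).injective).2 hp
  refine ⟨⟨q, hqpath⟩, ?_⟩
  change q.support.map toZ2 = s
  rw [hq, SimpleGraph.Walk.support_copy, SimpleGraph.Walk.support_map, List.map_map, ← hsupp]
  conv_rhs => rw [← List.map_id p.support]
  refine List.map_congr_left fun x _ => ?_
  change toZ2 (ofZ2 x) = x
  exact toZ2_ofZ2 x

/-! ## The weight of an event as a list sum over the enumeration -/

/-- **The fugacity-`x` weight of an event read on codes.**  If `p` tests membership in `E` on codes, then
`weightAt x Ω 1 a b E = ofReal (Σ_{s ∈ L.filter p} x^{|s|−1})` for the duplicate-free enumeration `L` of the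
codes `a → b`. [folklore] -/
theorem weightAt_eq_ofReal_sum {a b : Site 2} {N : ℕ} (hN : ∀ γ : SAW.DomainSAW Ω 1 a b, γ.length ≤ N)
    (hnodup : ((pathsFrom eqZ2 (nbV inV) N (toZ2 a) []).filter (endsAt eqZ2 (toZ2 b))).Nodup)
    (p : List (ℤ × ℤ) → Bool) (E : Set (SAW.DomainSAW Ω 1 a b))
    (hE : ∀ γ, γ ∈ E ↔ p (γ.walk.support.map toZ2) = true) {x : ℝ} (hx : 0 ≤ x) :
    weightAt x Ω 1 a b E = ENNReal.ofReal
      (((((pathsFrom eqZ2 (nbV inV) N (toZ2 a) []).filter (endsAt eqZ2 (toZ2 b))).filter p).map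
        fun s => x ^ (s.length - 1)).sum) := by
  classical
  set L := (pathsFrom eqZ2 (nbV inV) N (toZ2 a) []).filter (endsAt eqZ2 (toZ2 b)) with hL
  set code : SAW.DomainSAW Ω 1 a b → List (ℤ × ℤ) := fun γ => γ.walk.support.map toZ2 with hcode
  have hinj : Function.Injective code := code_injective
  -- the chord type is finite: it injects into the listed codes
  haveI : Finite (SAW.DomainSAW Ω 1 a b) := by
    refine Finite.of_injective (fun γ => (⟨code γ, ?_⟩ : {s // s ∈ L})) fun γ γ' h => hinj ?_
    · exact code_mem_enum hB hN γ
    · simpa using h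
  letI : Fintype (SAW.DomainSAW Ω 1 a b) := Fintype.ofFinite _
  rw [weightAt_apply, tsum_fintype]
  have hterm : ∀ γ : SAW.DomainSAW Ω 1 a b, x ^ γ.length = x ^ ((code γ).length - 1) := fun γ => by
    simp only [hcode, List.length_map, SimpleGraph.Walk.length_support, Nat.add_sub_cancel]
    rfl
  calc ∑ γ, E.indicator (fun γ => ENNReal.ofReal (x ^ γ.length)) γ
      = ∑ γ ∈ Finset.univ.filter (· ∈ E), ENNReal.ofReal (x ^ γ.length) := by
        rw [Finset.sum_filter]
        refine Finset.sum_congr rfl fun γ _ => ?_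
        by_cases h : γ ∈ E <;> simp [h]
    _ = ∑ γ ∈ Finset.univ.filter (· ∈ E), ENNReal.ofReal (x ^ ((code γ).length - 1)) :=
        Finset.sum_congr rfl fun γ _ => by rw [hterm]
    _ = ∑ s ∈ (Finset.univ.filter (· ∈ E)).image code, ENNReal.ofReal (x ^ (s.length - 1)) :=
        (Finset.sum_image (f := fun s => ENNReal.ofReal (x ^ (s.length - 1))) fun γ _ γ' _ h => hinj h).symm
    _ = ∑ s ∈ (L.filter p).toFinset, ENNReal.ofReal (x ^ (s.length - 1)) := by
        refine Finset.sum_congr ?_ fun _ _ => rfl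
        ext s
        simp only [Finset.mem_image, Finset.mem_filter, Finset.mem_univ, true_and, List.mem_toFinset,
          List.mem_filter]
        constructor
        · rintro ⟨γ, hγ, rfl⟩
          exact ⟨code_mem_enum hB hN γ, (hE γ).1 hγ⟩
        · rintro ⟨hsL, hps⟩
          obtain ⟨γ, hγ⟩ := exists_chord_of_mem_enum hB hsL
          exact ⟨γ, (hE γ).2 (by rw [hγ]; exact hps), hγ⟩
    _ = ((L.filter p).map fun s => ENNReal.ofReal (x ^ (s.length - 1))).sum :=
        List.sum_toFinset _ (hnodup.filter p)
    _ = ENNReal.ofReal (((L.filter p).map fun s => x ^ (s.length - 1)).sum) := by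
        induction (L.filter p) with
        | nil => simp
        | cons s l ih =>
          simp only [List.map_cons, List.sum_cons]
          rw [ih, ENNReal.ofReal_add (pow_nonneg hx _)]
          exact List.sum_nonneg fun t ht => by
            rw [List.mem_map] at ht
            obtain ⟨m, -, rfl⟩ := ht
            exact pow_nonneg hx _

end Graph

/-! ## Regrouping a list sum by length: the census polynomial -/

/-- Number of listed codes with `n + 1` sites (= chords of length `n`), as an integer. [folklore] -/
def census {α : Type*} (K : List (List α)) (n : ℕ) : ℤ := ((K.filter fun s => s.length == n + 1).length : ℤ)

/-- The coefficient list `[census 0, …, census N]`. [folklore] -/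
def censusList {α : Type*} (K : List (List α)) (N : ℕ) : List ℤ := (List.range (N + 1)).map (census K)

/-- `length_censusList` (auxiliary). [folklore] -/
@[simp] theorem length_censusList {α : Type*} (K : List (List α)) (N : ℕ) : (censusList K N).length = N + 1 := by
  simp [censusList]

/-- `getD_censusList` (auxiliary). [folklore] -/
theorem getD_censusList {α : Type*} (K : List (List α)) (N : ℕ) {i : ℕ} (hi : i < N + 1) :
    (censusList K N).getD i 0 = census K i := by
  rw [List.getD_eq_getElem?_getD, censusList, List.getElem?_map, List.getElem?_range hi]
  rfl

/-- `census_nil` (auxiliary). [folklore] -/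
@[simp] theorem census_nil {α : Type*} (n : ℕ) : census ([] : List (List α)) n = 0 := rfl

/-- `census_cons` (auxiliary). [folklore] -/
theorem census_cons {α : Type*} (s : List α) (K : List (List α)) (n : ℕ) :
    census (s :: K) n = census K n + if s.length = n + 1 then 1 else 0 := by
  unfold census
  rw [List.filter_cons]
  by_cases h : s.length = n + 1
  · simp [h]
  · simp [h]

/-- **The census polynomial**: for codes with between `1` and `N + 1` sites,
`Σ_{s ∈ K} x^{|s|−1} = Σ_{i ≤ N} (censusList K N)[i] · xⁱ`. [folklore] -/
theorem sum_pow_eq_census {α : Type*} (K : List (List α)) (N : ℕ)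
    (hK : ∀ s ∈ K, 1 ≤ s.length ∧ s.length ≤ N + 1) (x : ℝ) :
    (K.map fun s => x ^ (s.length - 1)).sum =
      ∑ i ∈ Finset.range (censusList K N).length, ((censusList K N).getD i 0 : ℝ) * x ^ i := by
  rw [length_censusList]
  induction K with
  | nil =>
    rw [List.map_nil, List.sum_nil]
    symm
    refine Finset.sum_eq_zero fun i hi => ?_
    rw [getD_censusList _ _ (Finset.mem_range.1 hi), census_nil]
    simp
  | cons s K ih =>
    rw [List.map_cons, List.sum_cons, ih fun t ht => hK t (List.mem_cons_of_mem _ ht)]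
    have hs := hK s List.mem_cons_self
    have hsplit : ∀ i ∈ Finset.range (N + 1), ((censusList (s :: K) N).getD i 0 : ℝ) * x ^ i =
        ((censusList K N).getD i 0 : ℝ) * x ^ i + (if i = s.length - 1 then x ^ i else 0) := by
      intro i hi
      rw [Finset.mem_range] at hi
      rw [getD_censusList _ _ hi, getD_censusList _ _ hi, census_cons]
      by_cases h : i = s.length - 1
      · subst h
        rw [if_pos (by omega), if_pos rfl]; push_cast; ring
      · rw [if_neg (by omega), if_neg h]; push_cast; ring
    rw [Finset.sum_congr rfl hsplit, Finset.sum_add_distrib, Finset.sum_ite_eq']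
    rw [if_pos (Finset.mem_range.2 (by omega))]
    ring

/-- Listed codes have between `1` and `N + 1` sites when they come from chords of length `≤ N`
(the form in which `sum_pow_eq_census` is applied to an enumeration). [folklore] -/
theorem length_bounds_of_enum {Ω : Set ℂ} {inV : ℤ × ℤ → Bool}
    (hB : ∀ x y : Site 2, (discreteDomainGraph Ω 1).Adj x y ↔
      (zdGraph 2).Adj x y ∧ inV (toZ2 x) = true ∧ inV (toZ2 y) = true)
    {a b : Site 2} {N : ℕ} (hN : ∀ γ : SAW.DomainSAW Ω 1 a b, γ.length ≤ N) (p : List (ℤ × ℤ) → Bool) :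
    ∀ s ∈ ((pathsFrom eqZ2 (nbV inV) N (toZ2 a) []).filter (endsAt eqZ2 (toZ2 b))).filter p,
      1 ≤ s.length ∧ s.length ≤ N + 1 := by
  intro s hs
  rw [List.mem_filter] at hs
  obtain ⟨γ, hγ⟩ := exists_chord_of_mem_enum hB hs.1
  rw [← hγ, List.length_map, SimpleGraph.Walk.length_support]
  have := hN γ
  change γ.walk.length ≤ N at this
  omega

end Summit.CriticalPhenomena.SAWScalingLimit.Theorems.LeftRightFKG.Negative.Census
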